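import Mathlib
import Literature.RingTheory.GaloisAlgebras.ChaseHarrisonRosenberg

/-!
# Cyclic divisorial transfer — flatness of the fixed ring at a prime moved by `σ`

`B` a domain, `σ` a ring automorphism with `σ ^ p = 1` (`p` prime), `A = B^σ`, `𝔮 ⊂ B` a prime with
`σ⁻¹𝔮 ≠ 𝔮`, `𝔭 = 𝔮 ∩ A`. Then the canonical local homomorphism `A_𝔭 → B_𝔮` is flat
(Chase–Harrison–Rosenberg: on `S⁻¹B`, `S = A ∖ 𝔭`, the cyclic group generated by `σ` acts freely with
ring of invariants `S⁻¹A = A_𝔭`, so `S⁻¹B` is flat over `A_𝔭`, and `B_𝔮` is a localisation of `S⁻¹B`).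

## References

* [Greither1992CyclicGalois] C. Greither, *Cyclic Galois Extensions of Commutative Rings*, LNM 1534,
  Ch. 0, Thm. 1.6, Lemma 1.9.
* [SGA1] A. Grothendieck, *Revêtements étales et groupe fondamental*, Exp. V, Prop. 2.2 / Cor. 2.4.
-/

set_option linter.dupNamespace false

noncomputable section

namespace Summit.ResolutionOfSingularities.ResolutionOfSingularities.Theorems.WildQuotientResolution.CyclicTransfer

/-- The augmentation ideal of a power `τ ^ k` is contained in the augmentation ideal of `τ`:
`τᵏ b - b = ∑_{l<k} (τ (τˡ b) - τˡ b)`. [folklore] -/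
theorem locFreeFlat_span_pow_apply_sub_le {R : Type*} [CommRing R] (τ : R ≃+* R) (k : ℕ) :
    Ideal.span (Set.range fun b : R => (τ ^ k) b - b) ≤
      Ideal.span (Set.range fun b : R => τ b - b) := by
  refine Ideal.span_le.mpr ?_
  rintro _ ⟨b, rfl⟩
  change (τ ^ k) b - b ∈ Ideal.span (Set.range fun b : R => τ b - b)
  induction k generalizing b with
  | zero => simp
  | succ k ih =>
    have h : (τ ^ (k + 1)) b - b = ((τ ^ k) (τ b) - τ b) + (τ b - b) := by
      rw [pow_succ, RingAut.mul_apply]; abel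
    rw [h]
    exact Ideal.add_mem _ (ih (τ b)) (Ideal.subset_span ⟨b, rfl⟩)

/-- If `σ ^ p = 1` and the prime `𝔮` is moved by `σ` (`σ⁻¹𝔮 ≠ 𝔮`), then the augmentation ideal
`(σ b - b : b ∈ B)` is contained in none of the primes `(σʲ)⁻¹ 𝔮` of the orbit of `𝔮`: otherwise that
prime is `σ`-stable, hence equal to `σ⁻ʲᵖ𝔮 = 𝔮`, and `𝔮` would be `σ`-stable. [folklore] -/
theorem locFreeFlat_span_sub_not_le_comap_pow {B : Type*} [CommRing B] {p : ℕ} (hp : 0 < p)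
    (σ : B ≃+* B) (hσp : σ ^ p = 1) (𝔮 : Ideal B) (h𝔮 : 𝔮.comap σ ≠ 𝔮) (j : ℕ) :
    ¬ Ideal.span (Set.range fun b : B => σ b - b) ≤ 𝔮.comap (σ ^ j) := by
  intro hle
  apply h𝔮
  obtain ⟨k, rfl⟩ : ∃ k, p = k + 1 := ⟨p - 1, (Nat.succ_pred_eq_of_pos hp).symm⟩
  -- inverse identities for the powers of `σ`
  have hinvA : ∀ (n : ℕ) (b : B), (σ ^ (k * n)) ((σ ^ n) b) = b := fun n b => by
    rw [← RingAut.mul_apply, ← pow_add, ← Nat.succ_mul, pow_mul, hσp, one_pow, RingAut.one_apply]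
  have hinvB : ∀ (n : ℕ) (b : B), (σ ^ n) ((σ ^ (k * n)) b) = b := fun n b => by
    rw [← RingAut.mul_apply, ← pow_add, add_comm, ← Nat.succ_mul, pow_mul, hσp, one_pow,
      RingAut.one_apply]
  -- `P b` : `b` lies in the orbit prime `(σʲ)⁻¹ 𝔮`
  have hmem : ∀ b, b ∈ 𝔮.comap (σ ^ j) ↔ (σ ^ j) b ∈ 𝔮 := fun b => Ideal.mem_comap
  have h1 : ∀ b, (σ ^ j) b ∈ 𝔮 → (σ ^ j) (σ b) ∈ 𝔮 := fun b hb => by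
    have h : σ b - b ∈ 𝔮.comap (σ ^ j) := hle (Ideal.subset_span ⟨b, rfl⟩)
    rw [hmem, map_sub] at h
    simpa using 𝔮.add_mem h hb
  have h2 : ∀ (n : ℕ) (b : B), (σ ^ j) b ∈ 𝔮 → (σ ^ j) ((σ ^ n) b) ∈ 𝔮 := by
    intro n
    induction n with
    | zero => intro b hb; simpa using hb
    | succ n ih => intro b hb; rw [pow_succ', RingAut.mul_apply]; exact h1 _ (ih b hb)
  have h3 : ∀ (n : ℕ) (b : B), (σ ^ j) ((σ ^ n) b) ∈ 𝔮 → (σ ^ j) b ∈ 𝔮 := fun n b hb => by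
    have h := h2 (k * n) _ hb
    rwa [hinvA] at h
  have h4 : ∀ b, (σ ^ j) b ∈ 𝔮 ↔ b ∈ 𝔮 := fun b => by
    constructor
    · intro hb
      have h := h2 (k * j) b hb
      rwa [hinvB] at h
    · intro hb
      rw [← hinvB j b] at hb
      exact h3 _ _ hb
  ext b
  rw [Ideal.mem_comap, ← h4, ← h4 b]
  constructor
  · intro hb
    exact h3 1 b (by simpa using hb)
  · exact h1 b

/-- **The norm element.** If `σ ^ p = 1` (`p` prime) and `𝔮` is a prime moved by `σ`, there is a
`σ`-invariant `f ∉ 𝔮` in the augmentation ideal `(σ b - b : b ∈ B)`: prime avoidance gives `c` in the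
augmentation ideal outside all `(σʲ)⁻¹𝔮`, `j < p`, and `f = ∏_{j<p} σʲ c`. [folklore; SGA1 Exp. V §2] -/
theorem locFreeFlat_exists_norm {B : Type*} [CommRing B] {p : ℕ} (hp : p.Prime) (σ : B ≃+* B)
    (hσp : σ ^ p = 1) (𝔮 : Ideal B) [𝔮.IsPrime] (h𝔮 : 𝔮.comap σ ≠ 𝔮) :
    ∃ f : B, σ f = f ∧ f ∉ 𝔮 ∧ f ∈ Ideal.span (Set.range fun b : B => σ b - b) := by
  classical
  have havoid : ¬ ((Ideal.span (Set.range fun b : B => σ b - b) : Set B) ⊆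
      ⋃ i ∈ (↑(Finset.range p) : Set ℕ), ((𝔮.comap (σ ^ i) : Ideal B) : Set B)) := by
    rw [Ideal.subset_union_prime 0 0 fun i _ _ _ => inferInstance]
    rintro ⟨i, -, hi⟩
    exact locFreeFlat_span_sub_not_le_comap_pow hp.pos σ hσp 𝔮 h𝔮 i hi
  obtain ⟨c, hcI, hc⟩ := Set.not_subset.mp havoid
  simp only [Set.mem_iUnion, not_exists, Finset.mem_range, SetLike.mem_coe, Ideal.mem_comap] at hc
  obtain ⟨k, rfl⟩ : ∃ k, p = k + 1 := ⟨p - 1, (Nat.succ_pred_eq_of_pos hp.pos).symm⟩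
  refine ⟨∏ j ∈ Finset.range (k + 1), (σ ^ j) c, ?_, ?_, ?_⟩
  · calc σ (∏ j ∈ Finset.range (k + 1), (σ ^ j) c)
          = ∏ j ∈ Finset.range (k + 1), (σ ^ (j + 1)) c := by
            rw [map_prod]
            exact Finset.prod_congr rfl fun j _ => by rw [pow_succ', RingAut.mul_apply]
      _ = ∏ j ∈ Finset.range (k + 1), (σ ^ j) c := by
            rw [Finset.prod_range_succ (fun j => (σ ^ (j + 1)) c) k,
              Finset.prod_range_succ' (fun j => (σ ^ j) c) k, hσp, pow_zero]
  · rw [Ideal.IsPrime.prod_mem_iff]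
    rintro ⟨i, hi, hi𝔮⟩
    exact hc i (Finset.mem_range.mp hi) hi𝔮
  · obtain ⟨d, hd⟩ : c ∣ ∏ j ∈ Finset.range (k + 1), (σ ^ j) c := by
      have h := Finset.dvd_prod_of_mem (fun j => (σ ^ j) c) (Finset.mem_range.mpr k.succ_pos)
      rwa [pow_zero, RingAut.one_apply] at h
    rw [hd]
    exact Ideal.mul_mem_right d _ hcI

/-- **Chase–Harrison–Rosenberg for a cyclic action made free by localisation.** `B` a domain,
`σ ^ p = 1` (`p` prime), `A ⊆ B` the fixed subring, `M ⊆ A ∖ {0}` a submonoid containing an element `f`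
of the augmentation ideal `(σ b - b)`. Then on `B' = M⁻¹B` every power `σⁱ ≠ 1` has unit augmentation
ideal (it contains `f`), the invariants of `B'` are `M⁻¹A`, and so `B'` is flat over `M⁻¹A`
(`Literature.RingTheory.GaloisAlgebras.flat_of_free`).
[cite: Greither1992CyclicGalois, Ch. 0 Thm. 1.6 and Lemma 1.9] -/
theorem locFreeFlat_moduleFlat_localization {B : Type*} [CommRing B] [IsDomain B] {p : ℕ}
    (hp : p.Prime) (σ : B ≃+* B) (hσp : σ ^ p = 1) (A : Subring B) (hA : ∀ b, b ∈ A ↔ σ b = b)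
    (M : Submonoid A) (hM : (0 : A) ∉ M) {f : A} (hfM : f ∈ M)
    (hfI : (f : B) ∈ Ideal.span (Set.range fun b : B => σ b - b)) :
    Module.Flat (Localization M) (Localization (Algebra.algebraMapSubmonoid B M)) := by
  classical
  let T : Submonoid B := Algebra.algebraMapSubmonoid B M
  let A' := Localization M
  let B' := Localization T
  -- elements of `T` are fixed by `σ` and are non-zero-divisors
  have hTfix : ∀ t ∈ T, σ t = t := by
    rintro _ ⟨m, -, rfl⟩
    exact (hA _).mp m.2
  have hT0 : T ≤ nonZeroDivisors B := by
    rintro _ ⟨m, hm, rfl⟩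
    refine mem_nonZeroDivisors_of_ne_zero fun h => hM ?_
    rwa [show m = 0 from Subtype.ext h] at hm
  have hinj : Function.Injective (algebraMap B B') := IsLocalization.injective B' hT0
  have hσT : T.map σ.toMonoidHom = T := by
    ext t
    constructor
    · rintro ⟨s, hs, rfl⟩
      change σ s ∈ T
      rwa [hTfix s hs]
    · exact fun ht => ⟨t, ht, hTfix t ht⟩
  -- the extension of `σ` to `B'` and its powers
  let σT : B' ≃+* B' := IsLocalization.ringEquivOfRingEquiv B' B' σ hσT
  have hσT_alg : ∀ b : B, σT (algebraMap B B' b) = algebraMap B B' (σ b) := fun b =>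
    IsLocalization.ringEquivOfRingEquiv_eq hσT b
  have hσT_pow : ∀ (n : ℕ) (b : B), (σT ^ n) (algebraMap B B' b) = algebraMap B B' ((σ ^ n) b) := by
    intro n
    induction n with
    | zero => intro b; simp
    | succ n ih =>
      intro b
      rw [pow_succ', RingAut.mul_apply, ih, hσT_alg, pow_succ', RingAut.mul_apply]
  have hσ_pow_A : ∀ (n : ℕ) (a : B), a ∈ A → (σ ^ n) a = a := by
    intro n a ha
    induction n with
    | zero => simp
    | succ n ih => rw [pow_succ', RingAut.mul_apply, ih, (hA a).mp ha]
  have hσT_p : σT ^ p = 1 := by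
    refine RingEquiv.ext fun x => ?_
    have h := IsLocalization.ringHom_ext T (j := ((σT ^ p : B' ≃+* B') : B' →+* B'))
      (k := RingHom.id B') ?_
    · exact RingHom.congr_fun h x
    · ext b
      simp only [RingHom.comp_apply, RingHom.coe_coe, RingHom.id_apply]
      rw [hσT_pow, hσp, RingAut.one_apply]
  have hfin : IsOfFinOrder σT := isOfFinOrder_iff_pow_eq_one.mpr ⟨p, hp.pos, hσT_p⟩
  haveI : Finite (Subgroup.zpowers σT) := Set.finite_coe_iff.mpr hfin.finite_zpowers
  letI : Fintype (Subgroup.zpowers σT) := Fintype.ofFinite _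
  -- the powers of `σT` fix `A'`
  have hfixA' : ∀ (n : ℕ) (a : A'), (σT ^ n) (algebraMap A' B' a) = algebraMap A' B' a := by
    intro n
    have h : ((σT ^ n : B' ≃+* B') : B' →+* B').comp (algebraMap A' B') = algebraMap A' B' := by
      refine IsLocalization.ringHom_ext M ?_
      ext a
      simp only [RingHom.comp_apply, RingHom.coe_coe]
      rw [← IsScalarTower.algebraMap_apply A A' B' a, IsScalarTower.algebraMap_apply A B B' a,
        hσT_pow]
      exact congrArg (algebraMap B B') (hσ_pow_A n _ a.2)
    exact fun a => RingHom.congr_fun h a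
  haveI : SMulCommClass (Subgroup.zpowers σT) A' B' := ⟨fun g a x => by
    obtain ⟨n, hn⟩ : ∃ n : ℕ, σT ^ n = (g : B' ≃+* B') :=
      (hfin.mem_powers_iff_mem_zpowers).mpr g.2
    rw [Algebra.smul_def, Algebra.smul_def, smul_mul']
    congr 1
    change (g : B' ≃+* B') (algebraMap A' B' a) = algebraMap A' B' a
    rw [← hn]
    exact hfixA' n a⟩
  -- the invariants of `B'` are `A'`
  haveI : Algebra.IsInvariant A' B' (Subgroup.zpowers σT) := by
    refine ⟨fun x hx => ?_⟩
    have hx1 : σT x = x := hx ⟨σT, Subgroup.mem_zpowers σT⟩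
    obtain ⟨⟨b, t⟩, hbt⟩ := IsLocalization.surj T x
    obtain ⟨m, hm, hmt⟩ := t.2
    have hbt' : x * algebraMap B B' t = algebraMap B B' b := hbt
    have hσb : σ b = b := by
      apply hinj
      have h := congrArg σT hbt'
      rw [map_mul, hx1, hσT_alg, hσT_alg, hTfix _ t.2, hbt'] at h
      exact h.symm
    refine ⟨IsLocalization.mk' A' (⟨b, (hA b).mpr hσb⟩ : A) ⟨m, hm⟩, ?_⟩
    rw [IsLocalization.algebraMap_mk' B A' B', IsLocalization.mk'_eq_iff_eq_mul]
    change algebraMap B B' b = x * algebraMap B B' (algebraMap A B m)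
    rw [hmt, hbt']
  haveI : FaithfulSMul A' B' := (faithfulSMul_iff_algebraMap_injective A' B').mpr
    (localizationAlgebra_injective (M := M) (S := B) A' B' fun _ _ h => Subtype.ext h)
  -- freeness: the augmentation ideal of `σT` contains the unit `f`
  have hunit : IsUnit (algebraMap B B' (f : B)) :=
    IsLocalization.map_units B' (⟨_, Algebra.mem_algebraMapSubmonoid_of_mem (⟨f, hfM⟩ : M)⟩ : T)
  have hJσT : Ideal.span (Set.range fun x : B' => σT x - x) = ⊤ := by
    refine Ideal.eq_top_of_isUnit_mem _ ?_ hunit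
    have h : (Ideal.span (Set.range fun b : B => σ b - b)).map (algebraMap B B') ≤
        Ideal.span (Set.range fun x : B' => σT x - x) := by
      rw [Ideal.map_span]
      refine Ideal.span_mono ?_
      rintro _ ⟨_, ⟨b, rfl⟩, rfl⟩
      exact ⟨algebraMap B B' b, by simp [hσT_alg]⟩
    exact h (Ideal.mem_map_of_mem _ hfI)
  have hfree : ∀ g : Subgroup.zpowers σT, g ≠ 1 →
      Ideal.span (Set.range fun b : B' => g • b - b) = ⊤ := by
    intro g hg
    obtain ⟨n, hn⟩ : ∃ n : ℕ, σT ^ n = (g : B' ≃+* B') :=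
      (hfin.mem_powers_iff_mem_zpowers).mpr g.2
    have hpn : ¬ p ∣ n := by
      rintro ⟨d, rfl⟩
      refine hg (Subtype.ext ?_)
      rw [← hn, pow_mul, hσT_p, one_pow]
      rfl
    obtain ⟨m, -, hm⟩ :=
      Nat.exists_mul_mod_eq_one_of_coprime (hp.coprime_iff_not_dvd.mpr hpn).symm hp.one_lt
    have hστ : (σT ^ n) ^ m = σT := by
      rw [← pow_mul, ← Nat.mod_add_div (n * m) p, hm, pow_add, pow_one, pow_mul, hσT_p, one_pow,
        mul_one]
    have hgs : ∀ b : B', g • b = (σT ^ n) b := fun b => by rw [hn]; rfl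
    rw [eq_top_iff, ← hJσT]
    calc Ideal.span (Set.range fun x : B' => σT x - x)
        = Ideal.span (Set.range fun x : B' => ((σT ^ n) ^ m) x - x) := by rw [hστ]
      _ ≤ Ideal.span (Set.range fun x : B' => (σT ^ n) x - x) :=
          locFreeFlat_span_pow_apply_sub_le _ _
      _ = Ideal.span (Set.range fun x : B' => g • x - x) := by simp_rw [hgs]
  exact Literature.RingTheory.GaloisAlgebras.flat_of_free A' (Subgroup.zpowers σT) hfree

/-- If `M⁻¹B` is flat over `A` for a submonoid `M ⊆ A` whose image misses the prime `𝔮 ⊂ B`, then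
`B_𝔮`, a localisation of `M⁻¹B`, is flat over `A`. [folklore] -/
theorem locFreeFlat_moduleFlat_atPrime_of_localization {A B : Type*} [CommRing A] [CommRing B]
    [Algebra A B] (M : Submonoid A) (𝔮 : Ideal B) [𝔮.IsPrime]
    (hM : Algebra.algebraMapSubmonoid B M ≤ 𝔮.primeCompl)
    [Module.Flat A (Localization (Algebra.algebraMapSubmonoid B M))] :
    Module.Flat A (Localization.AtPrime 𝔮) := by
  let B' := Localization (Algebra.algebraMapSubmonoid B M)
  letI : Algebra B' (Localization.AtPrime 𝔮) := IsLocalization.localizationAlgebraOfSubmonoidLe B'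
    (Localization.AtPrime 𝔮) (Algebra.algebraMapSubmonoid B M) 𝔮.primeCompl hM
  haveI : IsScalarTower B B' (Localization.AtPrime 𝔮) :=
    IsLocalization.localization_isScalarTower_of_submonoid_le B' (Localization.AtPrime 𝔮) _ _ hM
  haveI : IsLocalization (𝔮.primeCompl.map (algebraMap B B')) (Localization.AtPrime 𝔮) :=
    IsLocalization.isLocalization_of_submonoid_le B' (Localization.AtPrime 𝔮) _ _ hM
  haveI : Module.Flat B' (Localization.AtPrime 𝔮) :=
    IsLocalization.flat (Localization.AtPrime 𝔮) (𝔮.primeCompl.map (algebraMap B B'))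
  haveI : IsScalarTower A B' (Localization.AtPrime 𝔮) := IsScalarTower.of_algebraMap_eq fun a => by
    rw [IsScalarTower.algebraMap_apply A B (Localization.AtPrime 𝔮) a,
      IsScalarTower.algebraMap_apply A B B' a]
    exact IsScalarTower.algebraMap_apply B B' (Localization.AtPrime 𝔮) _
  exact Module.Flat.trans A B' (Localization.AtPrime 𝔮)

/-- If `B_𝔮` is flat over `A`, then the induced local homomorphism `A_𝔭 → B_𝔮` (`𝔭 = 𝔮 ∩ A`) is flat
(flatness over `A` and over the localisation `A_𝔭` agree for `A_𝔭`-modules). [folklore] -/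
theorem locFreeFlat_flat_localRingHom_of_moduleFlat {A B : Type*} [CommRing A] [CommRing B]
    [Algebra A B] (𝔮 : Ideal B) [𝔮.IsPrime] [Module.Flat A (Localization.AtPrime 𝔮)] :
    (Localization.localRingHom (𝔮.comap (algebraMap A B)) 𝔮 (algebraMap A B) rfl).Flat := by
  algebraize [Localization.localRingHom (𝔮.comap (algebraMap A B)) 𝔮 (algebraMap A B) rfl]
  have : IsScalarTower A (Localization.AtPrime (𝔮.comap (algebraMap A B)))
      (Localization.AtPrime 𝔮) :=
    .of_algebraMap_eq fun x ↦ (Localization.localRingHom_to_map _ _ _ rfl x).symm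
  rw [RingHom.Flat, Module.flat_iff_of_isLocalization
    (S := Localization.AtPrime (𝔮.comap (algebraMap A B)))
    (p := (𝔮.comap (algebraMap A B)).primeCompl)]
  infer_instance

/-- At a `σ`-moved prime `𝔮` of the domain `B` (`σ ^ p = 1`, `p` prime), `B_𝔮` is flat over the fixed
subring `A = B^σ`. [cite: Greither1992CyclicGalois, Ch. 0 Thm. 1.6; SGA1 Exp. V Prop. 2.2] -/
theorem locFreeFlat_moduleFlat_atPrime {B : Type*} [CommRing B] [IsDomain B] {p : ℕ} (hp : p.Prime)
    (σ : B ≃+* B) (hσp : σ ^ p = 1) (A : Subring B) (hA : ∀ b, b ∈ A ↔ σ b = b)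
    (𝔮 : Ideal B) [𝔮.IsPrime] (h𝔮 : 𝔮.comap σ ≠ 𝔮) :
    Module.Flat A (Localization.AtPrime 𝔮) := by
  obtain ⟨f, hfσ, hf𝔮, hfI⟩ := locFreeFlat_exists_norm hp σ hσp 𝔮 h𝔮
  let 𝔭 : Ideal A := 𝔮.comap (algebraMap A B)
  have hfA : f ∈ A := (hA f).mpr hfσ
  have hfM : (⟨f, hfA⟩ : A) ∈ 𝔭.primeCompl := hf𝔮
  have hM0 : (0 : A) ∉ 𝔭.primeCompl := fun h => h 𝔭.zero_mem
  haveI := locFreeFlat_moduleFlat_localization hp σ hσp A hA 𝔭.primeCompl hM0 hfM hfI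
  haveI : Module.Flat A (Localization.AtPrime 𝔭) := IsLocalization.flat _ 𝔭.primeCompl
  haveI : Module.Flat A (Localization (Algebra.algebraMapSubmonoid B 𝔭.primeCompl)) :=
    Module.Flat.trans A (Localization.AtPrime 𝔭) _
  refine locFreeFlat_moduleFlat_atPrime_of_localization 𝔭.primeCompl 𝔮 ?_
  rintro _ ⟨m, hm, rfl⟩
  exact hm

/-- **`stub_locFreeFlat` (Chase–Harrison–Rosenberg): at a prime MOVED by `σ` the fixed ring is flat
below.** `B` a domain, `σ` of prime order `p` (`σ ^ p = 1`), `A = B^σ`, `𝔮` a prime with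
`σ⁻¹𝔮 ≠ 𝔮`, `𝔭 = 𝔮 ∩ A`. Then the canonical local map `A_𝔭 → B_𝔮` is flat. (The augmentation ideal
`I = (σ b - b)` lies in none of the orbit primes `σ⁻ʲ𝔮`, so prime avoidance gives `c ∈ I` outside all of
them; its norm `f = ∏_{j<p} σʲ c ∈ A ∖ 𝔭` lies in `I`, so on `S⁻¹B` (`S = A ∖ 𝔭`) every power `σⁱ ≠ 1` has
unit augmentation ideal — a FREE action with ring of invariants `S⁻¹A = A_𝔭` — and `S⁻¹B` is flat over
`A_𝔭` by Chase–Harrison–Rosenberg (`Literature.RingTheory.GaloisAlgebras.flat_of_free`); `B_𝔮` is a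
localisation of `S⁻¹B`.) [cite: Greither1992CyclicGalois, Ch. 0 Thm. 1.6; SGA1 Exp. V Prop. 2.2] -/
theorem stub_locFreeFlat {B : Type} [CommRing B] [IsDomain B] {p : ℕ} (hp : p.Prime)
    (σ : B ≃+* B) (hσp : σ ^ p = RingEquiv.refl B)
    (𝔮 : Ideal B) [𝔮.IsPrime] (h𝔮 : 𝔮.comap σ ≠ 𝔮) :
    (Localization.localRingHom (𝔮.comap ((σ : B →+* B).eqLocus (RingHom.id B)).subtype) 𝔮
        ((σ : B →+* B).eqLocus (RingHom.id B)).subtype rfl).Flat := by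
  haveI := locFreeFlat_moduleFlat_atPrime hp σ (hσp.trans RingAut.one_eq_refl.symm)
    ((σ : B →+* B).eqLocus (RingHom.id B)) (fun _ => Iff.rfl) 𝔮 h𝔮
  exact locFreeFlat_flat_localRingHom_of_moduleFlat (A := (σ : B →+* B).eqLocus (RingHom.id B)) 𝔮

end Summit.ResolutionOfSingularities.ResolutionOfSingularities.Theorems.WildQuotientResolution.CyclicTransfer

end
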